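import Summits.ResolutionOfSingularities.ResolutionOfSingularities.Theorems.FrobeniusClosingPatchingRelPerfectMonomialPolyhedraGame
import Mathlib.Order.WellFounded
import HarnessLib

/-!
# Crux `PatchingRelPerfect` (stmt-ResolutionOfSingularities-16161), chain w52 — TargetsF3 (m)
# «M2-strong», COMBINATORIAL HALF, file 2b: the STRATEGY SOCKET — any deterministic, permissible,
# terminating strategy WITH MEMORY wins the global permissible polyhedra game

[OURS · L1 W5.2 · res-L1-w52-plan-1 RULING M2 2026-08-27T06:34:44Z; fact-free; nothing here is a
statement of the manuscript under review]

File 2 (`…MonomialPolyhedraGameGlobal`, `InvariantPackage`) globalises a HISTORY-FREE upper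
semicontinuous local invariant.  The canonical resolution invariants that are known to work for sums
of monomials (Bierstone–Milman `inv`, Encinas–Villamayor `t`) are NOT history-free: they count «old»
boundary components relative to an epoch (the year the current order was first attained), and the
monomial part collects only the exceptional divisors created by the algorithm.  This file provides the
general socket such instances plug into: a `Strategy Θ Ω` carries a memory type `Θ` with its update
rule, a prescribed centre `next s θ : Option (Finset ℕ)`, and a termination measure `μ s θ` in a
well-ordered `Ω`; the axioms are exactly «`none` only at principal states», «the prescribed centre is
permissible», «memory well-formedness is preserved», «`μ` drops after the prescribed move at the
fresh index».  Theorem `Strategy.winnable`: every well-formed state with well-formed memory is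
`Winnable 0`; `Strategy.globalPermissiblePolyhedraGame`: if every well-formed state admits an initial
memory, the target of file 1 holds.  (File 2's `InvariantPackage` is the memory-free special case with
`μ = (max inv, #maximal centres)`.)
-/

-- `Summit.<Summit>.<Sub>.Theorems` with `Sub = Summit` (single-conjunct summit, D-0017)
set_option linter.dupNamespace false

namespace Summit.ResolutionOfSingularities.ResolutionOfSingularities.Theorems

namespace PolyhedraGame

open Finset

/-- [OURS] A fresh boundary index for a state: one more than every live index (exceptional
divisors are named in order of birth). -/
def State.fresh (s : State) : ℕ := s.B.sup id + 1

/-- [OURS] The fresh index is not live. -/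
theorem State.fresh_not_mem (s : State) : s.fresh ∉ s.B := by
  intro h
  have h2 : id s.fresh ≤ s.B.sup id := Finset.le_sup (f := id) h
  simp only [id, State.fresh] at h2
  omega

/-- [OURS] Every live index is smaller than the fresh one (birth order = index order). -/
theorem State.lt_fresh_of_mem (s : State) {b : ℕ} (hb : b ∈ s.B) : b < s.fresh := by
  have h2 : id b ≤ s.B.sup id := Finset.le_sup (f := id) hb
  simp only [id] at h2
  simp only [State.fresh]
  omega

/-- [OURS · W5.2 M2-strong] A DETERMINISTIC PERMISSIBLE STRATEGY WITH MEMORY for the global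
permissible polyhedra game: memory type `Θ` (e.g. epochs and monomial parts of a resolution
invariant), memory well-formedness `HWF`, memory update `upd` along a move, prescribed centre
`next` (`none` = stop), and a termination measure `μ` with values in a well-ordered type `Ω`. -/
structure Strategy (Θ Ω : Type*) [LT Ω] where
  /-- well-formed memory for a state -/
  HWF : State → Θ → Prop
  /-- memory after blowing up `J` with exceptional index `e` -/
  upd : State → Θ → Finset ℕ → ℕ → Θ
  /-- the prescribed centre, or `none` to stop -/
  next : State → Θ → Option (Finset ℕ)
  /-- the termination measure -/
  μ : State → Θ → Ω
  /-- the strategy stops only at principal states -/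
  principal_of_next_eq_none : ∀ s θ, s.WF → HWF s θ → next s θ = none → Principal s
  /-- the prescribed centre is a permissible stratum (inside the cosupport) -/
  permissible_of_next_eq_some : ∀ s θ J, s.WF → HWF s θ → next s θ = some J → Permissible s J
  /-- memory well-formedness survives the prescribed move at the fresh index -/
  hwf_move : ∀ s θ J, s.WF → HWF s θ → next s θ = some J →
    HWF (move s J s.fresh 0) (upd s θ J s.fresh)
  /-- the measure drops after the prescribed move at the fresh index -/
  μ_lt : ∀ s θ J, s.WF → HWF s θ → next s θ = some J →
    μ (move s J s.fresh 0) (upd s θ J s.fresh) < μ s θ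

namespace Strategy

variable {Θ Ω : Type*} [LT Ω]

/-- [OURS · W5.2 M2-strong] **A deterministic permissible terminating strategy with memory wins the
global permissible polyhedra game** (well-founded induction on the measure). -/
theorem winnable [WellFoundedLT Ω] (S : Strategy Θ Ω) :
    ∀ (s : State) (θ : Θ), s.WF → S.HWF s θ → Winnable 0 s := by
  suffices h : ∀ (o : Ω) (s : State) (θ : Θ), S.μ s θ = o → s.WF → S.HWF s θ → Winnable 0 s from
    fun s θ hs hθ => h _ s θ rfl hs hθ
  intro o
  induction o using WellFoundedLT.induction with
  | ind o ih =>
    intro s θ ho hs hθ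
    cases hJ : S.next s θ with
    | none => exact Winnable.done (S.principal_of_next_eq_none s θ hs hθ hJ)
    | some J =>
      refine Winnable.step J s.fresh (S.permissible_of_next_eq_some s θ J hs hθ hJ)
        s.fresh_not_mem ?_
      exact ih _ (ho ▸ S.μ_lt s θ J hs hθ hJ) _ _ rfl (WF.move hs J s.fresh 0)
        (S.hwf_move s θ J hs hθ hJ)

/-- [OURS · W5.2 M2-strong] If every well-formed state admits a well-formed initial memory, a
strategy discharges the target of file 1. -/
theorem globalPermissiblePolyhedraGame [WellFoundedLT Ω] (S : Strategy Θ Ω)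
    (init : ∀ s : State, s.WF → ∃ θ, S.HWF s θ) : GlobalPermissiblePolyhedraGame := by
  intro s hs
  obtain ⟨θ, hθ⟩ := init s hs
  exact S.winnable s θ hs hθ

end Strategy

end PolyhedraGame

end Summit.ResolutionOfSingularities.ResolutionOfSingularities.Theorems
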